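import Summits.NavierStokesRegularity.NavierStokesRegularity.Theses.RellichScar
import Summits.NavierStokesRegularity.NavierStokesRegularity.Theorems.ScarRigidity.Negative.LogicAndLoadBearing
import Literature.Analysis.FluidPDE.TypeIAncientMild
import Literature.Analysis.FluidPDE.ParasiticSlabFlow
import Literature.Analysis.FluidPDE.WholeSpaceIBPIntegrable
import Literature.Analysis.FluidPDE.PressureDeterminedUpToTime
import Literature.Analysis.FluidPDE.MildSolutionProofs
import HarnessLib

/-!
# `ScarRigidity` — line `finite-energy-log-convexity`, stub `stub_coulombEnergyPackage`:
# whole-space integration by parts with slowly decaying fluxes (crux stmt-NavierStokesRegularity-11717)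

Helper file 1 of S4-E (`stub_coulombEnergyPackage`, the Coulomb energy package of the difference
`w = V₁ - V₂` of two apex profiles). The Newtonian potential `ψ = Γ ⋆ w` of a density `w = O(ρ⁻³)`
decays only like `‖x‖^{-1/2}` (crudely) and its gradient like `‖x‖^{-7/4}`, so the fluxes
`⟪∂ᵢψ, ψ⟫`, `⟪∂ᵢw, ψ⟫`, `π ψ` of the Green / pressure identities of the Agmon–Nirenberg frame are
**not** integrable; they are, however, integrable against the weight `(1 + ‖x‖)⁻¹`, which is all the
truncation argument needs (`|∇χ_R| ≲ R⁻¹ 1_{R ≤ ‖x‖ ≤ 2R} ≲ (1 + ‖x‖)⁻¹`):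

* `integral_divergence_eq_zero_of_weighted` — **`∫ div Z = 0`** for `Z ∈ C¹(E; E)` with
  `div Z ∈ L¹` and `(1 + ‖x‖)⁻¹ ‖Z‖ ∈ L¹` (truncation by the tree's `cutoff R`, dominated convergence
  on both sides; Evans, *PDE*, App. C.2; Leray 1934 §6 (1.11));
* `integral_fderiv_apply_eq_zero_of_weighted` — `∫ ∂ᵥH = 0` for `H ∈ C¹` with `∂ᵥH ∈ L¹`,
  `(1 + ‖x‖)⁻¹ H ∈ L¹`;
* `integral_inner_laplacian_add_eq_zero_of_weighted` — **Green's first identity**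
  `∫ ⟪Δv, u⟫ + Σᵢ ∫ ⟪∂ᵢv, ∂ᵢu⟫ = 0` for `v ∈ C²`, `u ∈ C¹` with `⟪∂ᵢv, ∂ᵢu⟫`, `⟪∂ᵢ∂ᵢv, u⟫ ∈ L¹` and the
  fluxes `(1 + ‖x‖)⁻¹ ⟪∂ᵢv, u⟫ ∈ L¹`;
* `integral_inner_gradient_eq_zero_of_weighted` — **the pressure drops out**: `∫ ⟪∇p, φ⟫ = 0` for
  `p ∈ C¹`, `φ ∈ C¹` divergence free, `⟪φ, ∇p⟫ ∈ L¹`, `(1 + ‖x‖)⁻¹ |p| ‖φ‖ ∈ L¹`.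
-/

noncomputable section

open Set Filter Function MeasureTheory Metric TopologicalSpace
open scoped Topology ENNReal NNReal InnerProductSpace RealInnerProductSpace
open Literature.Analysis.FluidPDE
open Summit.NavierStokesRegularity.NavierStokesRegularity.Theses.RellichScar
open Summit.NavierStokesRegularity.NavierStokesRegularity.Theorems.ScarRigidity.Negative

set_option linter.dupNamespace false

namespace Summit.NavierStokesRegularity.NavierStokesRegularity.Theorems.RellichScarScarRigidity

open scoped Laplacian

variable {E : Type*} [NormedAddCommGroup E] [InnerProductSpace ℝ E] [FiniteDimensional ℝ E]
  [MeasurableSpace E] [BorelSpace E]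
variable {F' : Type*} [NormedAddCommGroup F'] [InnerProductSpace ℝ F']

/-! ## The gradient of the cut-off lives in the shell `R ≤ ‖x‖ ≤ 2R` -/

omit [FiniteDimensional ℝ E] [MeasurableSpace E] [BorelSpace E] in
/-- **The gradient of `χ_R` is `O((1 + ‖x‖)⁻¹)` uniformly in `R ≥ 1`**: if `‖Dχ_R‖ ≤ C/R`
everywhere, then `‖Dχ_R(x)‖ ≤ 3C (1 + ‖x‖)⁻¹` (the cut-off is locally `0` for `‖x‖ > 2R`, so the
derivative vanishes there, and `1 + ‖x‖ ≤ 3R` otherwise). [folklore] -/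
theorem norm_fderiv_cutoff_le_weight {C : ℝ} (hC0 : 0 ≤ C)
    (hC : ∀ R : ℝ, 0 < R → ∀ x : E, ‖fderiv ℝ (cutoff R) x‖ ≤ C / R) {R : ℝ} (hR : 1 ≤ R) (x : E) :
    ‖fderiv ℝ (cutoff R) x‖ ≤ 3 * C * (1 + ‖x‖)⁻¹ := by
  have hR0 : 0 < R := by linarith
  have hx0 : 0 < 1 + ‖x‖ := by positivity
  by_cases hx : 2 * R < ‖x‖
  · have hev : cutoff (E := E) R =ᶠ[𝓝 x] fun _ => (0 : ℝ) := by
      filter_upwards [(isOpen_lt continuous_const continuous_norm).mem_nhds hx] with y hy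
      exact cutoff_eq_zero hR0 (le_of_lt hy)
    rw [hev.fderiv_eq, fderiv_const_apply, norm_zero]
    positivity
  · rw [not_lt] at hx
    have h3 : 1 + ‖x‖ ≤ 3 * R := by linarith
    calc ‖fderiv ℝ (cutoff R) x‖ ≤ C / R := hC R hR0 x
      _ = 3 * C / (3 * R) := by field_simp
      _ ≤ 3 * C / (1 + ‖x‖) := div_le_div_of_nonneg_left (by positivity) hx0 h3
      _ = 3 * C * (1 + ‖x‖)⁻¹ := div_eq_mul_inv _ _

/-! ## No boundary terms for weighted-integrable fields -/

/-- **Divergence theorem on the whole space with an `O(1/‖x‖)`-integrable field.** For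
`Z ∈ C¹(E; E)` with `div Z ∈ L¹` and `(1 + ‖x‖)⁻¹ ‖Z(x)‖ ∈ L¹`, `∫ div Z = 0`: with the cut-offs
`χ_R`, `∫ χ_R div Z = -∫ ⟪Z, ∇χ_R⟫`; the left side tends to `∫ div Z` and the right side to `0` by
dominated convergence (`∇χ_R → 0` pointwise, `|⟪Z, ∇χ_R⟫| ≤ 3C (1 + ‖x‖)⁻¹ ‖Z‖`). The `L¹` case is the
tree's `integral_divergence_eq_zero_of_integrable` (Evans, *PDE*, App. C.2; Leray 1934 §6 (1.11)).
[cite: Leray1934, §6 (1.11) p. 203] -/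
theorem integral_divergence_eq_zero_of_weighted {Z : E → E} (hZ : ContDiff ℝ 1 Z)
    (hwt : Integrable fun x => (1 + ‖x‖)⁻¹ * ‖Z x‖)
    (hdiv : Integrable fun x => VectorCalculus.divergence Z x) :
    ∫ x, VectorCalculus.divergence Z x = 0 := by
  obtain ⟨C, hC0, hC⟩ := exists_norm_fderiv_cutoff_le (E := E)
  -- `∫ χ_R div Z = -∫ ⟪Z, ∇χ_R⟫` for `R = n + 1`
  have hn : ∀ n : ℕ, ∫ x, cutoff ((n : ℝ) + 1) x * VectorCalculus.divergence Z x =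
      -∫ x, ⟪Z x, gradient (cutoff ((n : ℝ) + 1)) x⟫ := by
    intro n
    have h := integral_mul_divergence_add_eq_zero_left (contDiff_cutoff _) hZ
      (hasCompactSupport_cutoff (E := E) (R := (n : ℝ) + 1) (by positivity))
    linarith
  -- the left side tends to `∫ div Z`
  have hL : Tendsto (fun n : ℕ => ∫ x, cutoff ((n : ℝ) + 1) x * VectorCalculus.divergence Z x)
      atTop (𝓝 (∫ x, VectorCalculus.divergence Z x)) := by
    refine tendsto_integral_of_dominated_convergence (fun x => ‖VectorCalculus.divergence Z x‖)
      (fun n => ((contDiff_cutoff (n := 0) _).continuous.aestronglyMeasurable.mul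
        hdiv.aestronglyMeasurable))
      hdiv.norm ?_ ?_
    · intro n
      filter_upwards with x
      rw [norm_mul]
      exact mul_le_of_le_one_left (norm_nonneg _)
        (by rw [Real.norm_eq_abs]; exact abs_cutoff_le_one _ _)
    · filter_upwards with x
      simpa using (tendsto_cutoff_natCast_add_one x).mul_const (VectorCalculus.divergence Z x)
  -- the right side tends to `0` (dominated convergence)
  have hR : Tendsto (fun n : ℕ => ∫ x, ⟪Z x, gradient (cutoff ((n : ℝ) + 1)) x⟫) atTop (𝓝 0) := by
    have h0 : (0 : ℝ) = ∫ _ : E, (0 : ℝ) := by simp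
    rw [h0]
    refine tendsto_integral_of_dominated_convergence (fun x => 3 * C * ((1 + ‖x‖)⁻¹ * ‖Z x‖))
      (fun n => ?_) (hwt.const_mul _) (fun n => ?_) ?_
    · exact hZ.continuous.aestronglyMeasurable.inner
        (continuous_gradient_of_contDiff (contDiff_cutoff (n := 1) _)).aestronglyMeasurable
    · filter_upwards with x
      have h1 : (1 : ℝ) ≤ (n : ℝ) + 1 := by simp
      calc ‖⟪Z x, gradient (cutoff ((n : ℝ) + 1)) x⟫‖
          ≤ ‖Z x‖ * ‖gradient (cutoff ((n : ℝ) + 1)) x‖ := norm_inner_le_norm _ _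
        _ ≤ ‖Z x‖ * (3 * C * (1 + ‖x‖)⁻¹) := by
            gcongr
            rw [gradient, LinearIsometryEquiv.norm_map]
            exact norm_fderiv_cutoff_le_weight hC0 hC h1 x
        _ = 3 * C * ((1 + ‖x‖)⁻¹ * ‖Z x‖) := by ring
    · filter_upwards with x
      have hev : ∀ᶠ n : ℕ in atTop, ⟪Z x, gradient (cutoff ((n : ℝ) + 1)) x⟫ = 0 := by
        filter_upwards [eventually_gt_atTop ⌈‖x‖⌉₊] with n hn
        have hlt : ‖x‖ < (n : ℝ) + 1 := by
          have := Nat.le_ceil ‖x‖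
          have hn' : (⌈‖x‖⌉₊ : ℝ) < n := by exact_mod_cast hn
          linarith
        rw [gradient, fderiv_cutoff_eq_zero (by positivity) hlt, map_zero, inner_zero_right]
      exact tendsto_const_nhds.congr' (hev.mono fun n hn => hn.symm)
  -- conclusion
  have hL' : Tendsto (fun n : ℕ => ∫ x, cutoff ((n : ℝ) + 1) x * VectorCalculus.divergence Z x)
      atTop (𝓝 0) := by
    simp_rw [hn]
    simpa using hR.neg
  exact tendsto_nhds_unique hL hL'

/-- **`∫ ∂ᵥH = 0`** for `H ∈ C¹(E; ℝ)` with `∂ᵥH ∈ L¹` and `(1 + ‖x‖)⁻¹ H ∈ L¹` (the divergence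
theorem for the field `H • v`, whose divergence is `∂ᵥH`). [folklore] -/
theorem integral_fderiv_apply_eq_zero_of_weighted {H : E → ℝ} (hH : ContDiff ℝ 1 H) (v : E)
    (hwt : Integrable fun x => (1 + ‖x‖)⁻¹ * |H x|) (hd : Integrable fun x => fderiv ℝ H x v) :
    ∫ x, fderiv ℝ H x v = 0 := by
  have hdiv : ∀ x, VectorCalculus.divergence (fun y => H y • v) x = fderiv ℝ H x v := fun x =>
    divergence_smul_const_eq_fderiv_apply (hH.differentiable one_ne_zero x) v
  have hwt' : Integrable fun x => (1 + ‖x‖)⁻¹ * ‖H x • v‖ := by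
    have : (fun x => (1 + ‖x‖)⁻¹ * ‖H x • v‖) = fun x => ((1 + ‖x‖)⁻¹ * |H x|) * ‖v‖ := by
      funext x; rw [norm_smul, Real.norm_eq_abs]; ring
    rw [this]
    exact hwt.mul_const _
  have h := integral_divergence_eq_zero_of_weighted (Z := fun y => H y • v)
    (hH.smul contDiff_const) hwt' (by simp_rw [hdiv]; exact hd)
  simp_rw [hdiv] at h
  exact h

/-! ## Green's first identity with weighted-integrable fluxes -/

/-- **Green's first identity without boundary, weighted form.** For `v ∈ C²(E; F')`,
`u ∈ C¹(E; F')` and an orthonormal basis `b`: if `⟪∂ᵢv, ∂ᵢu⟫`, `⟪∂ᵢ∂ᵢv, u⟫ ∈ L¹` and the fluxes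
satisfy `(1 + ‖x‖)⁻¹ ⟪∂ᵢv, u⟫ ∈ L¹` for every `i`, then `∫ ⟪Δv, u⟫ + Σᵢ ∫ ⟪∂ᵢv, ∂ᵢu⟫ = 0`
(`∂ᵢ⟪∂ᵢv, u⟫ = ⟪∂ᵢv, ∂ᵢu⟫ + ⟪∂ᵢ∂ᵢv, u⟫`, summed and integrated; Evans App. C.2 Thm. 3 with empty
boundary, Leray 1934 §6 (1.11)). [cite: Leray1934, §6 (1.11) p. 203] -/
theorem integral_inner_laplacian_add_eq_zero_of_weighted {ι : Type*} [Fintype ι]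
    (b : OrthonormalBasis ι ℝ E) {v u : E → F'} (hv : ContDiff ℝ 2 v) (hu : ContDiff ℝ 1 u)
    (hH : ∀ i, Integrable fun x => (1 + ‖x‖)⁻¹ * |⟪fderiv ℝ v x (b i), u x⟫|)
    (hi₁ : ∀ i, Integrable fun x => ⟪fderiv ℝ v x (b i), fderiv ℝ u x (b i)⟫)
    (hi₂ : ∀ i, Integrable fun x => ⟪fderiv ℝ (fun y => fderiv ℝ v y (b i)) x (b i), u x⟫) :
    (∫ x, ⟪(Δ v) x, u x⟫) + ∑ i, ∫ x, ⟪fderiv ℝ v x (b i), fderiv ℝ u x (b i)⟫ = 0 := by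
  have hdv : ∀ i, ContDiff ℝ 1 fun y => fderiv ℝ v y (b i) := fun i =>
    (hv.fderiv_right (m := 1) le_rfl).clm_apply contDiff_const
  -- the scalar functions `Hᵢ = ⟪∂ᵢ v, u⟫`
  set H : ι → E → ℝ := fun i x => ⟪fderiv ℝ v x (b i), u x⟫ with hHdef
  have hHc : ∀ i, ContDiff ℝ 1 (H i) := fun i => (hdv i).inner ℝ hu
  have hHd : ∀ i x, fderiv ℝ (H i) x (b i) =
      ⟪fderiv ℝ v x (b i), fderiv ℝ u x (b i)⟫ +
        ⟪fderiv ℝ (fun y => fderiv ℝ v y (b i)) x (b i), u x⟫ := fun i x => by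
    rw [hHdef, fderiv_inner_apply ℝ ((hdv i).differentiable one_ne_zero x)
      (hu.differentiable one_ne_zero x)]
  -- sum the identities `∫ ∂ᵢ Hᵢ = 0`
  have hsum : ∑ i, ((∫ x, ⟪fderiv ℝ v x (b i), fderiv ℝ u x (b i)⟫) +
      ∫ x, ⟪fderiv ℝ (fun y => fderiv ℝ v y (b i)) x (b i), u x⟫) = 0 := by
    refine Finset.sum_eq_zero fun i _ => ?_
    have hdi : Integrable fun x => fderiv ℝ (H i) x (b i) := by
      simp_rw [hHd]; exact (hi₁ i).add (hi₂ i)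
    rw [← integral_add (hi₁ i) (hi₂ i),
      ← integral_fderiv_apply_eq_zero_of_weighted (hHc i) (b i) (hH i) hdi]
    exact integral_congr_ae (Eventually.of_forall fun x => (hHd i x).symm)
  rw [Finset.sum_add_distrib, ← integral_finsetSum _ fun i _ => hi₂ i] at hsum
  have hlap : ∀ x, ∑ i, ⟪fderiv ℝ (fun y => fderiv ℝ v y (b i)) x (b i), u x⟫ =
      ⟪(Δ v) x, u x⟫ := fun x => by
    rw [← sum_inner, laplacian_eq_sum_fderiv_fderiv b hv x]
  simp_rw [hlap] at hsum
  linarith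

/-! ## The pressure drops out against divergence-free fields (weighted form) -/

/-- **`∫ ⟪∇p, φ⟫ = 0`** for `p ∈ C¹(E; ℝ)` and a divergence-free `φ ∈ C¹(E; E)` with `⟪φ, ∇p⟫ ∈ L¹`
and `(1 + ‖x‖)⁻¹ |p| ‖φ‖ ∈ L¹` (`div (p φ) = p div φ + ⟪φ, ∇p⟫ = ⟪φ, ∇p⟫` and the weighted divergence
theorem; Leray 1934, (17): the pressure disappears from the weak relation). [cite: Leray1934, §6 (1.11) p. 203] -/
theorem integral_inner_gradient_eq_zero_of_weighted {p : E → ℝ} {φ : E → E} (hp : ContDiff ℝ 1 p)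
    (hφ : ContDiff ℝ 1 φ) (hdiv : VectorCalculus.IsDivFree φ)
    (hwt : Integrable fun x => (1 + ‖x‖)⁻¹ * (|p x| * ‖φ x‖))
    (h1 : Integrable fun x => ⟪φ x, gradient p x⟫) :
    ∫ x, ⟪gradient p x, φ x⟫ = 0 := by
  have hd : ∀ x, VectorCalculus.divergence (fun y => p y • φ y) x = ⟪φ x, gradient p x⟫ := fun x => by
    rw [divergence_smul_apply (hp.differentiable one_ne_zero x) (hφ.differentiable one_ne_zero x),
      hdiv x, mul_zero, zero_add]
  have hwt' : Integrable fun x => (1 + ‖x‖)⁻¹ * ‖p x • φ x‖ := by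
    refine hwt.congr (Eventually.of_forall fun x => ?_)
    simp only [norm_smul, Real.norm_eq_abs]
  have h := integral_divergence_eq_zero_of_weighted (Z := fun y => p y • φ y) (hp.smul hφ) hwt'
    (by simp_rw [hd]; exact h1)
  simp_rw [hd] at h
  rw [← h]
  exact integral_congr_ae (Eventually.of_forall fun x => real_inner_comm _ _)

/-! ## Registered sub-goal (helper stub of `stub_coulombEnergyPackage`) -/

/-- **Registered helper stub `stub_weightedGreenIdentity`** (crux stmt-NavierStokesRegularity-11717,
line `finite-energy-log-convexity`, helper of S4-E): Green's first identity on `ℝ³` with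
`(1 + ‖x‖)⁻¹`-integrable fluxes, in the standard basis, as registered. [folklore] -/
theorem stub_weightedGreenIdentity :
    ∀ (v w : EuclideanSpace ℝ (Fin 3) → EuclideanSpace ℝ (Fin 3)), ContDiff ℝ 2 v → ContDiff ℝ 1 w →
      (∀ i : Fin 3, Integrable (fun x => (1 + ‖x‖)⁻¹ *
        |⟪fderiv ℝ v x (EuclideanSpace.basisFun (Fin 3) ℝ i), w x⟫|) volume) →
      (∀ i : Fin 3, Integrable (fun x => ⟪fderiv ℝ v x (EuclideanSpace.basisFun (Fin 3) ℝ i),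
        fderiv ℝ w x (EuclideanSpace.basisFun (Fin 3) ℝ i)⟫) volume) →
      (∀ i : Fin 3, Integrable (fun x =>
        ⟪fderiv ℝ (fun y => fderiv ℝ v y (EuclideanSpace.basisFun (Fin 3) ℝ i)) x
          (EuclideanSpace.basisFun (Fin 3) ℝ i), w x⟫) volume) →
      (∫ x, ⟪Laplacian.laplacian v x, w x⟫) +
        ∑ i : Fin 3, ∫ x, ⟪fderiv ℝ v x (EuclideanSpace.basisFun (Fin 3) ℝ i),
          fderiv ℝ w x (EuclideanSpace.basisFun (Fin 3) ℝ i)⟫ = 0 :=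
  fun _v _w hv hw hH hi₁ hi₂ =>
    integral_inner_laplacian_add_eq_zero_of_weighted (EuclideanSpace.basisFun (Fin 3) ℝ) hv hw hH
      hi₁ hi₂

end Summit.NavierStokesRegularity.NavierStokesRegularity.Theorems.RellichScarScarRigidity

end
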